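import Summits.NavierStokesRegularity.FunctionalMining.NoGo.StrainMomentHeatCoerciveLtTwo
import Literature.Analysis.FluidPDE.SignedPowers
import Mathlib.MeasureTheory.Integral.IntervalIntegral.Periodic
import HarnessLib

/-!
# NO-GO K37a — two real-analysis tools for laminate heat-coercivity below `q = 2`: the sharp
# Dirichlet–Poincaré inequality `π²∫h² ≤ ∫h′²` (Picone), and the regularised signed powers `(x² + η²)^b·x`

search for candidate a priori estimates; no regularity claim.

Cell `pub-nsfunc` (NS FUNCTIONAL MINING), NOGO seat (gen 47). This file is the scalar toolbox of K37b
(`NoGo/TopEigHeatLaminateWirtinger`: the `x₂`-laminate class is heat-coercive for EVERY real `q > 1` at the rate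
`4π²(q−1)/q`, door (c) / node K6 / Lemma L-λ(q) of the cell; L-λ(q) = `TopEig.TopEigHeatCoercivePos q` stays OPEN
in the kernel for every real `q > 1`). Nothing here mentions a velocity field; nothing about Navier–Stokes is
proved or asserted. Contents, all [folklore] or elementary [ours], kernel-checked, every import BUILT:
* `pi_sq_mul_integral_sq_le` — **Dirichlet–Poincaré with the sharp constant**: `h ∈ C¹`, `h(a) = h(a+1) = 0 ⇒
  π²∫ₐ^{a+1}h² ≤ ∫ₐ^{a+1}h′²`. Proof by Picone's identity with the positive supersolution `u = sin(k(x−a+δ))`,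
  `k = π/(1+2δ)`, `δ > 0` (so `u > 0` on the CLOSED interval and no endpoint limits are needed):
  `h′² − k²h² − (h²u′/u)′ = (h′u − hu′)²/u² ≥ 0`, the bracket vanishing at both ends; then `δ → 0⁺`
  (`TopEig.const_le_of_forall_pos_le`, K11d). The zero-mean Wirtinger inequality of `ProfileWirtinger` (constant
  `4π²`, mean-zero periodic) is a different statement and does not give this one.
* the regularised odd power `φ_{η,b}(x) = (x² + η²)^b·x`: joint continuity in `(η, x)` for `b > −1/2` including
  `η = 0` (`continuous_sqReg_mul`, from K11a `TopEig.continuous_rpow_normSq_add_sq_smul`), the `η = 0` slice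
  `(x²)^b·x = |x|^{2b}x` (`continuous_sqPow_mul`, `sq_rpow_eq_abs_rpow`, `sq_rpow_mul_sq`), the derivative
  `φ_{η,r}′(x) = (x²+η²)^{r−1}((2r+1)x² + η²)` for `η ≠ 0` (`hasDerivAt_sqReg_mul`), and the POINTWISE comparison
  `reg_deriv_sq_le` (`1 < q`, `η ≠ 0`): `(φ_{η,(q−2)/4}′(x)·y)² ≤ (q²/(4(q−1)))·φ_{η,(q−2)/2}′(x)·y²` — the slack is
  `(q−2)²(qx²η² + η⁴) ≥ 0` — which is what lets K37b run a Poincaré argument at `η > 0` and pass to `η → 0⁺`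
  without ever forming the singular weight `|x|^{q−2}`, `q < 2`.
[ours] search for candidate a priori estimates; no regularity claim.
FILING (prove seat g28, REQUEST #55): declarations byte-identical to the no-go seat's staged `TopEigHeatLaminateDirichlet.STAGING.lean` 9377f96f6588430a; this line is the only addition.
-/

noncomputable section

open MeasureTheory Set intervalIntegral Real Filter
open scoped Topology

namespace Summit.NavierStokesRegularity.FunctionalMining

open Literature.Analysis Literature.Analysis.FunctionSpaces Literature.Analysis.FunctionSpaces.Torus
open TopEig
open Literature.Analysis.FluidPDE.LeiZhang2011 (abs_rpow_mul_sq)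

namespace TopEigLaminate

/-! ## 1. The sharp Dirichlet–Poincaré inequality on a unit interval -/

/-- **Dirichlet–Poincaré inequality on a unit interval, sharp constant `π²`**: a `C¹` function `h` with
`h(a) = h(a+1) = 0` has `π²∫ₐ^{a+1} h² ≤ ∫ₐ^{a+1} h′²`. Picone's identity with the positive supersolution
`u = sin(k(x − a + δ))`, `k = π/(1+2δ)`: `h′² − k²h² − (h²u′/u)′ = (h′u − hu′)²/u² ≥ 0` on `[a, a+1]`, the
boundary term `h²u′/u` vanishing at both ends; then `δ → 0⁺`. [folklore] -/
theorem pi_sq_mul_integral_sq_le {h h' : ℝ → ℝ} {a : ℝ} (hd : ∀ x, HasDerivAt h (h' x) x)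
    (hc : Continuous h') (ha0 : h a = 0) (ha1 : h (a + 1) = 0) :
    π ^ 2 * ∫ x in a..a + 1, h x ^ 2 ≤ ∫ x in a..a + 1, h' x ^ 2 := by
  have hcon : Continuous h := continuous_iff_continuousAt.2 fun x => (hd x).continuousAt
  have hab : a ≤ a + 1 := by linarith
  refine (const_le_of_forall_pos_le (A := π ^ 2 * ∫ x in a..a + 1, h x ^ 2)
    (B := fun δ : ℝ => (1 + 2 * δ) ^ 2 * ∫ x in a..a + 1, h' x ^ 2) (by fun_prop) fun δ hδ _ => ?_).trans
    (by norm_num)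
  have h12 : 0 < 1 + 2 * δ := by linarith
  set k : ℝ := π / (1 + 2 * δ) with hk
  have hk0 : 0 < k := div_pos pi_pos h12
  have hθ : ∀ x, HasDerivAt (fun y : ℝ => k * (y - a + δ)) k x := fun x => by
    simpa using (((hasDerivAt_id x).sub_const a).add_const δ).const_mul k
  have hud : ∀ x, HasDerivAt (fun y : ℝ => sin (k * (y - a + δ))) (k * cos (k * (x - a + δ))) x :=
    fun x => ((hasDerivAt_sin _).comp x (hθ x)).congr_deriv (by ring)
  have hu'd : ∀ x, HasDerivAt (fun y : ℝ => k * cos (k * (y - a + δ))) (-k ^ 2 * sin (k * (x - a + δ))) x :=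
    fun x => (((hasDerivAt_cos _).comp x (hθ x)).const_mul k).congr_deriv (by ring)
  have hupos : ∀ x ∈ Icc a (a + 1), 0 < sin (k * (x - a + δ)) := fun x hx => by
    refine sin_pos_of_pos_of_lt_pi (mul_pos hk0 (by linarith [hx.1])) ?_
    calc k * (x - a + δ) ≤ k * (1 + δ) := mul_le_mul_of_nonneg_left (by linarith [hx.2]) hk0.le
      _ < π := by rw [hk, div_mul_eq_mul_div, div_lt_iff₀ h12]; nlinarith [mul_pos pi_pos hδ]
  have hf : ∀ x, HasDerivAt (fun y : ℝ => h y * h y * (k * cos (k * (y - a + δ))))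
      ((h' x * h x + h x * h' x) * (k * cos (k * (x - a + δ))) + h x * h x * (-k ^ 2 * sin (k * (x - a + δ)))) x :=
    fun x => ((hd x).mul (hd x)).mul (hu'd x)
  set w : ℝ → ℝ := fun y => h y * h y * (k * cos (k * (y - a + δ))) / sin (k * (y - a + δ)) with hw
  set w' : ℝ → ℝ := fun x =>
    (((h' x * h x + h x * h' x) * (k * cos (k * (x - a + δ))) + h x * h x * (-k ^ 2 * sin (k * (x - a + δ)))) *
        sin (k * (x - a + δ)) - h x * h x * (k * cos (k * (x - a + δ))) * (k * cos (k * (x - a + δ)))) /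
      sin (k * (x - a + δ)) ^ 2 with hw'
  have hwd : ∀ x ∈ Icc a (a + 1), HasDerivAt w (w' x) x := fun x hx => (hf x).div (hud x) (hupos x hx).ne'
  have hw'c : ContinuousOn w' (uIcc a (a + 1)) := by
    rw [uIcc_of_le hab]
    exact ContinuousOn.div (Continuous.continuousOn (by fun_prop)) (Continuous.continuousOn (by fun_prop))
      fun x hx => pow_ne_zero 2 (hupos x hx).ne'
  have hFTC : ∫ x in a..a + 1, w' x = 0 := by
    rw [integral_eq_sub_of_hasDerivAt (fun x hx => hwd x (by rwa [uIcc_of_le hab] at hx)) hw'c.intervalIntegrable]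
    simp [hw, ha0, ha1]
  have hpt : ∀ x ∈ Icc a (a + 1), k ^ 2 * h x ^ 2 ≤ h' x ^ 2 - w' x := fun x hx => by
    have hu := (hupos x hx).ne'
    have e : h' x ^ 2 - w' x - k ^ 2 * h x ^ 2 =
        (h' x * sin (k * (x - a + δ)) - h x * (k * cos (k * (x - a + δ)))) ^ 2 / sin (k * (x - a + δ)) ^ 2 := by
      rw [hw']; field_simp; ring
    nlinarith [e, div_nonneg (sq_nonneg (h' x * sin (k * (x - a + δ)) - h x * (k * cos (k * (x - a + δ)))))
      (sq_nonneg (sin (k * (x - a + δ))))]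
  have hi1 : IntervalIntegrable (fun x => h' x ^ 2) volume a (a + 1) := (hc.pow 2).intervalIntegrable _ _
  have hmono : ∫ x in a..a + 1, k ^ 2 * h x ^ 2 ≤ ∫ x in a..a + 1, (h' x ^ 2 - w' x) :=
    integral_mono_on hab ((hcon.pow 2).const_mul _ |>.intervalIntegrable _ _) (hi1.sub hw'c.intervalIntegrable) hpt
  rw [intervalIntegral.integral_const_mul, integral_sub hi1 hw'c.intervalIntegrable, hFTC, sub_zero] at hmono
  have eπ : π ^ 2 = (1 + 2 * δ) ^ 2 * k ^ 2 := by rw [hk]; field_simp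
  calc π ^ 2 * ∫ x in a..a + 1, h x ^ 2 = (1 + 2 * δ) ^ 2 * (k ^ 2 * ∫ x in a..a + 1, h x ^ 2) := by rw [eπ]; ring
    _ ≤ (1 + 2 * δ) ^ 2 * ∫ x in a..a + 1, h' x ^ 2 := mul_le_mul_of_nonneg_left hmono (sq_nonneg _)

/-! ## 2. Regularised signed powers `(x² + η²)^b·x` -/

/-- `(x²)^r = |x|^{2r}` for all real `x`, `r`. [folklore; bookkeeping] -/
theorem sq_rpow_eq_abs_rpow (x r : ℝ) : (x ^ 2) ^ r = |x| ^ (2 * r) := by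
  rw [← sq_abs, ← rpow_two, ← rpow_mul (abs_nonneg x)]

/-- `(x²)^{(q−2)/2}·x² = |x|^q` (`q ≠ 0`; both sides vanish at `x = 0`). [folklore; bookkeeping] -/
theorem sq_rpow_mul_sq (x : ℝ) {q : ℝ} (hq : q ≠ 0) : (x ^ 2) ^ ((q - 2) / 2) * x ^ 2 = |x| ^ q := by
  rw [sq_rpow_eq_abs_rpow, show 2 * ((q - 2) / 2) = q - 2 by ring, abs_rpow_mul_sq x (by simpa using hq)]
  ring_nf

/-- **Joint continuity of `(η, x) ↦ (x² + η²)^b·x` on `ℝ × ℝ` for `b > −1/2`** (the scalar case of K11a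
`TopEig.continuous_rpow_normSq_add_sq_smul`). [folklore] -/
theorem continuous_sqReg_mul {b : ℝ} (hb : -1 / 2 < b) :
    Continuous fun p : ℝ × ℝ => (p.2 ^ 2 + p.1 ^ 2) ^ b * p.2 :=
  (continuous_rpow_normSq_add_sq_smul (E := ℝ) hb).congr fun p => by
    simp only [Real.norm_eq_abs, sq_abs, smul_eq_mul]

/-- The `η = 0` slice: `x ↦ (x²)^b·x = |x|^{2b}x` is continuous for `b > −1/2` (for `2b = q − 2` this is the
gradient `|x|^{q−2}x` of `|x|^q/q`, continuous exactly when `q > 1`). [folklore] -/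
theorem continuous_sqPow_mul {b : ℝ} (hb : -1 / 2 < b) : Continuous fun x : ℝ => (x ^ 2) ^ b * x :=
  ((continuous_sqReg_mul hb).comp (continuous_const.prodMk continuous_id : Continuous fun x : ℝ => ((0 : ℝ), x))).congr
    fun x => by simp [Function.comp]

/-- **`d/dx[(x² + η²)^r·x] = (x² + η²)^{r−1}·((2r+1)x² + η²)`** (`η ≠ 0`, any real `r`). [folklore] -/
theorem hasDerivAt_sqReg_mul (r : ℝ) {η : ℝ} (hη : η ≠ 0) (x : ℝ) :
    HasDerivAt (fun y : ℝ => (y ^ 2 + η ^ 2) ^ r * y) ((x ^ 2 + η ^ 2) ^ (r - 1) * ((2 * r + 1) * x ^ 2 + η ^ 2)) x := by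
  have hw : 0 < x ^ 2 + η ^ 2 := add_pos_of_nonneg_of_pos (sq_nonneg x) (by positivity)
  have hb : HasDerivAt (fun y : ℝ => y ^ 2 + η ^ 2) (2 * x) x := by
    simpa using (hasDerivAt_pow 2 x).add_const (η ^ 2)
  refine ((hb.rpow_const (p := r) (Or.inl hw.ne')).mul (hasDerivAt_id x)).congr_deriv ?_
  rw [id, show (x ^ 2 + η ^ 2) ^ r = (x ^ 2 + η ^ 2) ^ (r - 1) * (x ^ 2 + η ^ 2) by
    rw [← rpow_add_one hw.ne']; ring_nf]
  ring

/-- **The pointwise comparison `(H_η′)² ≤ (q²/(4(q−1)))·φ_η′(G)·(G′)²`** behind the regularised Poincaré step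
(`H_η = (G²+η²)^{(q−2)/4}G`, `φ_η = (G²+η²)^{(q−2)/2}G`, derivatives by `hasDerivAt_sqReg_mul`), in the variables
`x = G(s)`, `y = G′(s)`, `w = x² + η² > 0`: `w^{(q−6)/2}(qx²/2 + η²)²y² ≤ (q²/(4(q−1)))·w^{(q−6)/2}·w·((q−1)x² + η²)y²`,
because `q²w((q−1)x² + η²) − (q−1)(qx² + 2η²)² = (q−2)²(qx²η² + η⁴) ≥ 0`. [ours; elementary] -/
theorem reg_deriv_sq_le {q η : ℝ} (hq : 1 < q) (hη : η ≠ 0) (x y : ℝ) :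
    ((x ^ 2 + η ^ 2) ^ ((q - 2) / 4 - 1) * ((2 * ((q - 2) / 4) + 1) * x ^ 2 + η ^ 2) * y) ^ 2 ≤
      q ^ 2 / (4 * (q - 1)) *
        ((x ^ 2 + η ^ 2) ^ ((q - 2) / 2 - 1) * ((2 * ((q - 2) / 2) + 1) * x ^ 2 + η ^ 2) * y ^ 2) := by
  have hw : 0 < x ^ 2 + η ^ 2 := add_pos_of_nonneg_of_pos (sq_nonneg x) (by positivity)
  have e1 : ((x ^ 2 + η ^ 2) ^ ((q - 2) / 4 - 1)) ^ 2 = (x ^ 2 + η ^ 2) ^ ((q - 6) / 2) := by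
    rw [← rpow_two, ← rpow_mul hw.le]; ring_nf
  have e2 : (x ^ 2 + η ^ 2) ^ ((q - 2) / 2 - 1) = (x ^ 2 + η ^ 2) ^ ((q - 6) / 2) * (x ^ 2 + η ^ 2) := by
    rw [← rpow_add_one hw.ne']; ring_nf
  have hA : 0 ≤ (x ^ 2 + η ^ 2) ^ ((q - 6) / 2) := rpow_nonneg hw.le _
  have h4 : 0 < 4 * (q - 1) := by linarith
  have hq1 : q - 1 ≠ 0 := ne_of_gt (by linarith)
  have hpoly : (q / 2 * x ^ 2 + η ^ 2) ^ 2 ≤ q ^ 2 / (4 * (q - 1)) * ((x ^ 2 + η ^ 2) * ((q - 1) * x ^ 2 + η ^ 2)) := by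
    rw [← sub_nonneg]
    have e : q ^ 2 / (4 * (q - 1)) * ((x ^ 2 + η ^ 2) * ((q - 1) * x ^ 2 + η ^ 2)) - (q / 2 * x ^ 2 + η ^ 2) ^ 2 =
        (q - 2) ^ 2 * (q * x ^ 2 * η ^ 2 + η ^ 4) / (4 * (q - 1)) := by
      field_simp; ring
    rw [e]; exact div_nonneg (by positivity) h4.le
  calc ((x ^ 2 + η ^ 2) ^ ((q - 2) / 4 - 1) * ((2 * ((q - 2) / 4) + 1) * x ^ 2 + η ^ 2) * y) ^ 2
        = (x ^ 2 + η ^ 2) ^ ((q - 6) / 2) * ((q / 2 * x ^ 2 + η ^ 2) ^ 2 * y ^ 2) := by rw [mul_pow, mul_pow, e1]; ring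
    _ ≤ (x ^ 2 + η ^ 2) ^ ((q - 6) / 2) * (q ^ 2 / (4 * (q - 1)) * ((x ^ 2 + η ^ 2) * ((q - 1) * x ^ 2 + η ^ 2)) * y ^ 2) :=
        mul_le_mul_of_nonneg_left (mul_le_mul_of_nonneg_right hpoly (sq_nonneg y)) hA
    _ = q ^ 2 / (4 * (q - 1)) * ((x ^ 2 + η ^ 2) ^ ((q - 2) / 2 - 1) * ((2 * ((q - 2) / 2) + 1) * x ^ 2 + η ^ 2) * y ^ 2) := by
        rw [e2]; ring

end TopEigLaminate

end Summit.NavierStokesRegularity.FunctionalMining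

end
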